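import Summits.QuantumFields.YangMills.Theorems.BalabanLadderNTReferencePackageTwoPoint
import Summits.QuantumFields.YangMills.Theorems.BalabanLadderNTReferencePackageThreePoint
import HarnessLib

/-!
# Crux `NT` (stmt-QuantumFields-19353): reference-state transfer, X — EXPLICIT-WITNESS forms of the kernel-reference
# composition (the test functions of the reference floors ARE the witnesses of the torus floors)

Helper file (`--supports stmt-QuantumFields-19353`) of the fleet lead prover of crux `NT` (unit `ym-spine-19353-p1`,
g4).  `lowerBounds_fst/snd_of_reference` (files IV–V) conclude the EXISTENTIAL clauses of `LowerBounds`; consumers that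
need more of the witnesses (e.g. the seam stub `UVSeamRec.stub_floorsEngine`, which asks `HasCompactSupport` of the
test functions) want the same conclusion for the GIVEN test functions.  Same proofs, unbundled hypotheses:

* `q2_floor_of_reference` — for the given `v, ε`: `∃ β₅' ∀ β ≥ β₅' ∀ L, σ+κ+1 ≤ aβ·L → ε ≤ Q2_{β,L,aβ}(θv, v)`;
* `q3_floor_of_reference` — for the given `f, g, h, ε`: the same for `|Q3_{β,L,aβ}(f,g,h)|`.

Refs: card `Cruxes/NT/Ideas/reference-state-transfer.md`; files IV–VI of this series.
-/

set_option autoImplicit false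

noncomputable section

open scoped SchwartzMap
open MeasureTheory Filter Topology
open Literature.MathematicalPhysics.QuantumFieldTheory Literature.MathematicalPhysics.QuantumLattice
open Literature.Probability.LatticeModels
open Summit.QuantumFields.YangMills.Cruxes.OSLegsFromFemtoAndGap.DlrCollarTransfer

namespace Summit.QuantumFields.YangMills.Cruxes.NT.Reference

section Explicit

variable (G : Type) [Group G] [TopologicalSpace G] [IsTopologicalGroup G] [CompactSpace G]
  [MeasurableSpace G] [BorelSpace G] (r : LatticeRep G)

/-- **Explicit-witness form of `lowerBounds_fst_of_reference`**: for the GIVEN test function `v` (supported in the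
ball of radius `σ`) and the given `ε`, (E1-osc) ∧ (E2-osc) ∧ the reference floor with margin for `β ≥ β₅` give
`Q2_{β,L,aβ}(θv, v) ≥ ε` for all `β ≥ β₅'` and every torus with `a β · L ≥ σ + κ + 1`. [folklore] -/
theorem q2_floor_of_reference (a : ℝ → ℝ) (ha₀ : ∀ β, 0 < a β) (ha : Tendsto a atTop (𝓝 0))
    {C₁ C₂ ℓ ρ σ κ : ℝ} (hC₁ : 0 ≤ C₁) (hC₂ : 0 ≤ C₂) (hσ : 0 < σ) (hκ : 0 < κ)
    (hℓ : 2 * (σ + κ) < ℓ) (hρ : σ + κ < ρ) (ηr : ℝ → LGConfig 4 G)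
    (hE1 : ∃ β₁ : ℝ, ∀ β : ℝ, β₁ ≤ β → ∀ (c : Fin 4 → ℤ) (b : ℕ), (b : ℝ) * a β ≤ ℓ →
      ∀ (η η' : LGConfig 4 G) (x : Fin 4 → ℤ), 1 ≤ depth c b x →
        |kerE G r β c b η (dens G r x) - kerE G r β c b η' (dens G r x)| ≤ C₁ / (depth c b x : ℝ) ^ 4)
    (hE2 : ∃ β₂ : ℝ, ∀ β : ℝ, β₂ ≤ β → ∀ (c : Fin 4 → ℤ) (b : ℕ), (b : ℝ) * a β ≤ ℓ →
      ∀ (η η' : LGConfig 4 G) (x y : Fin 4 → ℤ), 1 ≤ depth c b x → 1 ≤ depth c b y →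
        |kerCov G r β c b η (dens G r x) (dens G r y) - kerCov G r β c b η' (dens G r x) (dens G r y)| ≤
          C₂ / ((min (depth c b x) (depth c b y) : ℕ) : ℝ) ^ 4 / (1 + ‖siteToE (y - x)‖) ^ 4)
    (v : 𝓢(EuclideanSpace ℝ (Fin 4), ℝ)) (ε β₅ : ℝ)
    (hvσ : tsupport (v : EuclideanSpace ℝ (Fin 4) → ℝ) ⊆ Metric.closedBall 0 σ)
    (HR : ∀ β : ℝ, β₅ ≤ β →
        ε + 2 * (C₁ * (a β / κ) ^ 4 * ∑ x ∈ box 4 ⌈ρ / a β⌉₊, |thetaTest 4 v (a β • siteToE x)|) *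
              (C₁ * (a β / κ) ^ 4 * ∑ y ∈ box 4 ⌈ρ / a β⌉₊, |v (a β • siteToE y)|) +
            C₂ * (a β / κ) ^ 4 * ∑ x ∈ box 4 ⌈ρ / a β⌉₊, ∑ y ∈ box 4 ⌈ρ / a β⌉₊,
              |thetaTest 4 v (a β • siteToE x)| * |v (a β • siteToE y)| / (1 + ‖siteToE (y - x)‖) ^ 4 ≤
          ∑ x ∈ box 4 ⌈ρ / a β⌉₊, ∑ y ∈ box 4 ⌈ρ / a β⌉₊,
            thetaTest 4 v (a β • siteToE x) * v (a β • siteToE y) *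
              kerCov G r β (fun _ => -(⌈ρ / a β⌉₊ : ℤ)) (2 * ⌈ρ / a β⌉₊ + 1) (ηr β) (dens G r x) (dens G r y)) :
    ∃ β₅' : ℝ, ∀ β : ℝ, β₅' ≤ β → ∀ L : ℕ, σ + κ + 1 ≤ a β * L → ε ≤ Q2 G r β L (a β) (thetaTest 4 v) v := by
  obtain ⟨β₁, H1⟩ := hE1
  obtain ⟨β₂, H2⟩ := hE2
  -- smallness of the spacing
  have hδ : 0 < min (min (1 / 4 : ℝ) ((ρ - σ - κ) / 2)) ((ℓ - 2 * (σ + κ)) / 5) :=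
    lt_min (lt_min (by norm_num) (by linarith)) (by linarith)
  obtain ⟨βa, Ha⟩ := eventually_le_of_tendsto ha hδ
  refine ⟨max (max β₅ βa) (max β₁ β₂), fun β hβ L hL => ?_⟩
  have hβ₅ : β₅ ≤ β := le_trans (le_max_left _ _) (le_trans (le_max_left _ _) hβ)
  have hβa : βa ≤ β := le_trans (le_max_right _ _) (le_trans (le_max_left _ _) hβ)
  have hβ₁ : β₁ ≤ β := le_trans (le_max_left _ _) (le_trans (le_max_right _ _) hβ)
  have hβ₂ : β₂ ≤ β := le_trans (le_max_right _ _) (le_trans (le_max_right _ _) hβ)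
  have hα : 0 < a β := ha₀ β
  have hsmall := Ha β hβa
  have h4 : a β ≤ 1 / 4 := hsmall.trans ((min_le_left _ _).trans (min_le_left _ _))
  have hρ' : a β ≤ (ρ - σ - κ) / 2 := hsmall.trans ((min_le_left _ _).trans (min_le_right _ _))
  have hℓ' : a β ≤ (ℓ - 2 * (σ + κ)) / 5 := hsmall.trans (min_le_right _ _)
  obtain ⟨hRPR, hfem, hLL, hNL, hNR, hdep⟩ := scales hα hσ hκ h4 hρ' hℓ' hL (RP := ⌈(σ + κ) / a β⌉₊ + 1) rfl
  have HRβ := HR β hβ₅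
  -- notation (introduced after `HRβ`, so that it is rewritten too)
  set N := ⌈σ / a β⌉₊ with hN
  set R := ⌈ρ / a β⌉₊ with hR
  have hθ0 : ∀ x, x ∉ box 4 N → thetaTest 4 v (a β • siteToE x) = 0 := fun x hx =>
    thetaTest_smul_siteToE_eq_zero hα hvσ hx
  have hw0 : ∀ y, y ∉ box 4 N → v (a β • siteToE y) = 0 := fun y hy =>
    apply_smul_siteToE_eq_zero hα hvσ hy
  -- per-pair transfer
  have hpair : ∀ x ∈ box 4 N, ∀ y ∈ box 4 N,
      |(torusE G r β L (fun U => dens G r x U * dens G r y U) - torusE G r β L (dens G r x) * torusE G r β L (dens G r y))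
        - kerCov G r β (fun _ => -(R : ℤ)) (2 * R + 1) (ηr β) (dens G r x) (dens G r y)| ≤
      2 * (C₁ * (a β / κ) ^ 4) * (C₁ * (a β / κ) ^ 4) + C₂ * (a β / κ) ^ 4 / (1 + ‖siteToE (y - x)‖) ^ 4 :=
    fun x hx y hy => pair_transfer G r β hC₁ hC₂ hκ hα hRPR hfem hLL hdep (H1 β hβ₁) (H2 β hβ₂) (ηr β) hx hy
  -- the sums restricted to the support box
  have eQ : Q2 G r β L (a β) (thetaTest 4 v) v = ∑ x ∈ box 4 N, ∑ y ∈ box 4 N,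
      thetaTest 4 v (a β • siteToE x) * v (a β • siteToE y) *
        (torusE G r β L (fun U => dens G r x U * dens G r y U) -
          torusE G r β L (dens G r x) * torusE G r β L (dens G r y)) := by
    unfold Q2
    exact sum_box₂_eq hNL _ (fun x hx y => by rw [hθ0 x hx]; ring) (fun y hy x => by rw [hw0 y hy]; ring)
  have eR : ∑ x ∈ box 4 R, ∑ y ∈ box 4 R, thetaTest 4 v (a β • siteToE x) * v (a β • siteToE y) *
      kerCov G r β (fun _ => -(R : ℤ)) (2 * R + 1) (ηr β) (dens G r x) (dens G r y) =
      ∑ x ∈ box 4 N, ∑ y ∈ box 4 N, thetaTest 4 v (a β • siteToE x) * v (a β • siteToE y) *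
      kerCov G r β (fun _ => -(R : ℤ)) (2 * R + 1) (ηr β) (dens G r x) (dens G r y) :=
    sum_box₂_eq hNR _ (fun x hx y => by rw [hθ0 x hx]; ring) (fun y hy x => by rw [hw0 y hy]; ring)
  have e1 : ∑ x ∈ box 4 R, |thetaTest 4 v (a β • siteToE x)| = ∑ x ∈ box 4 N, |thetaTest 4 v (a β • siteToE x)| :=
    sum_box_eq_sum_box hNR _ fun x hx => by rw [hθ0 x hx, abs_zero]
  have e2 : ∑ y ∈ box 4 R, |v (a β • siteToE y)| = ∑ y ∈ box 4 N, |v (a β • siteToE y)| :=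
    sum_box_eq_sum_box hNR _ fun y hy => by rw [hw0 y hy, abs_zero]
  have e3 : ∑ x ∈ box 4 R, ∑ y ∈ box 4 R,
      |thetaTest 4 v (a β • siteToE x)| * |v (a β • siteToE y)| / (1 + ‖siteToE (y - x)‖) ^ 4 =
      ∑ x ∈ box 4 N, ∑ y ∈ box 4 N,
      |thetaTest 4 v (a β • siteToE x)| * |v (a β • siteToE y)| / (1 + ‖siteToE (y - x)‖) ^ 4 :=
    sum_box₂_eq hNR _ (fun x hx y => by rw [hθ0 x hx, abs_zero, zero_mul, zero_div])
      (fun y hy x => by rw [hw0 y hy, abs_zero, mul_zero, zero_div])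
  -- the weighted sum of the per-pair bounds
  have hsum := sum_sum_sub_le_of_abs_sub_le (box 4 N) (fun x => thetaTest 4 v (a β • siteToE x))
    (fun y => v (a β • siteToE y))
    (fun x y => torusE G r β L (fun U => dens G r x U * dens G r y U) -
      torusE G r β L (dens G r x) * torusE G r β L (dens G r y))
    (fun x y => kerCov G r β (fun _ => -(R : ℤ)) (2 * R + 1) (ηr β) (dens G r x) (dens G r y))
    (fun x y => C₂ * (a β / κ) ^ 4 / (1 + ‖siteToE (y - x)‖) ^ 4)
    (2 * (C₁ * (a β / κ) ^ 4) * (C₁ * (a β / κ) ^ 4)) hpair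
  have e4 : ∑ x ∈ box 4 N, ∑ y ∈ box 4 N, |thetaTest 4 v (a β • siteToE x)| * |v (a β • siteToE y)| *
      (C₂ * (a β / κ) ^ 4 / (1 + ‖siteToE (y - x)‖) ^ 4) =
      C₂ * (a β / κ) ^ 4 * ∑ x ∈ box 4 N, ∑ y ∈ box 4 N,
        |thetaTest 4 v (a β • siteToE x)| * |v (a β • siteToE y)| / (1 + ‖siteToE (y - x)‖) ^ 4 := by
    rw [Finset.mul_sum]
    refine Finset.sum_congr rfl fun x _ => ?_
    rw [Finset.mul_sum]
    refine Finset.sum_congr rfl fun y _ => ?_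
    ring
  rw [eR, e1, e2, e3] at HRβ
  rw [e4] at hsum
  rw [eQ]
  have hprod : 2 * (C₁ * (a β / κ) ^ 4 * ∑ x ∈ box 4 N, |thetaTest 4 v (a β • siteToE x)|) *
      (C₁ * (a β / κ) ^ 4 * ∑ y ∈ box 4 N, |v (a β • siteToE y)|) =
      2 * (C₁ * (a β / κ) ^ 4) * (C₁ * (a β / κ) ^ 4) *
        ((∑ x ∈ box 4 N, |thetaTest 4 v (a β • siteToE x)|) * ∑ y ∈ box 4 N, |v (a β • siteToE y)|) := by ring
  linarith [hsum, HRβ, hprod]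


/-- **Explicit-witness form of `lowerBounds_snd_of_reference`**: for the GIVEN `f, g, h` (supported in the ball of
radius `σ`) and `ε`, (E1/E2/E3-osc) ∧ the unsigned reference floor with margin give `|Q3_{β,L,aβ}(f,g,h)| ≥ ε` for all
`β ≥ β₅'` and every torus with `a β · L ≥ σ + κ + 1`. [folklore] -/
theorem q3_floor_of_reference (a : ℝ → ℝ) (ha₀ : ∀ β, 0 < a β) (ha : Tendsto a atTop (𝓝 0))
    {C₁ C₂ C₃ ℓ ρ σ κ : ℝ} (hC₁ : 0 ≤ C₁) (hC₂ : 0 ≤ C₂) (hC₃ : 0 ≤ C₃) (hσ : 0 < σ) (hκ : 0 < κ)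
    (hℓ : 2 * (σ + κ) < ℓ) (hρ : σ + κ < ρ) (ηr : ℝ → LGConfig 4 G)
    (hE1 : ∃ β₁ : ℝ, ∀ β : ℝ, β₁ ≤ β → ∀ (c : Fin 4 → ℤ) (b : ℕ), (b : ℝ) * a β ≤ ℓ →
      ∀ (η η' : LGConfig 4 G) (x : Fin 4 → ℤ), 1 ≤ depth c b x →
        |kerE G r β c b η (dens G r x) - kerE G r β c b η' (dens G r x)| ≤ C₁ / (depth c b x : ℝ) ^ 4)
    (hE2 : ∃ β₂ : ℝ, ∀ β : ℝ, β₂ ≤ β → ∀ (c : Fin 4 → ℤ) (b : ℕ), (b : ℝ) * a β ≤ ℓ →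
      ∀ (η η' : LGConfig 4 G) (x y : Fin 4 → ℤ), 1 ≤ depth c b x → 1 ≤ depth c b y →
        |kerCov G r β c b η (dens G r x) (dens G r y) - kerCov G r β c b η' (dens G r x) (dens G r y)| ≤
          C₂ / ((min (depth c b x) (depth c b y) : ℕ) : ℝ) ^ 4 / (1 + ‖siteToE (y - x)‖) ^ 4)
    (hE3 : ∃ β₃ : ℝ, ∀ β : ℝ, β₃ ≤ β → ∀ (c : Fin 4 → ℤ) (b : ℕ), (b : ℝ) * a β ≤ ℓ →
      ∀ (η η' : LGConfig 4 G) (x y z : Fin 4 → ℤ), 1 ≤ depth c b x → 1 ≤ depth c b y → 1 ≤ depth c b z →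
        |kerK3 G r β c b η x y z - kerK3 G r β c b η' x y z| ≤
          C₃ / ((min (min (depth c b x) (depth c b y)) (depth c b z) : ℕ) : ℝ) ^ 4 /
            (1 + min (min ‖siteToE (y - x)‖ ‖siteToE (z - y)‖) ‖siteToE (z - x)‖) ^ 8)
    (f g h : 𝓢(EuclideanSpace ℝ (Fin 4), ℝ)) (ε β₅ : ℝ)
    (hfσ : tsupport (f : EuclideanSpace ℝ (Fin 4) → ℝ) ⊆ Metric.closedBall 0 σ)
    (hgσ : tsupport (g : EuclideanSpace ℝ (Fin 4) → ℝ) ⊆ Metric.closedBall 0 σ)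
    (hhσ : tsupport (h : EuclideanSpace ℝ (Fin 4) → ℝ) ⊆ Metric.closedBall 0 σ)
    (HR : ∀ β : ℝ, β₅ ≤ β →
        ε + ∑ x ∈ box 4 ⌈ρ / a β⌉₊, ∑ y ∈ box 4 ⌈ρ / a β⌉₊, ∑ z ∈ box 4 ⌈ρ / a β⌉₊,
            |f (a β • siteToE x)| * |g (a β • siteToE y)| * |h (a β • siteToE z)| *
              (2 * ((C₁ * (a β / κ) ^ 4) * (C₂ * (a β / κ) ^ 4 / (1 + ‖siteToE (z - y)‖) ^ 4) +
                    (C₁ * (a β / κ) ^ 4) * (C₂ * (a β / κ) ^ 4 / (1 + ‖siteToE (z - x)‖) ^ 4) +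
                    (C₁ * (a β / κ) ^ 4) * (C₂ * (a β / κ) ^ 4 / (1 + ‖siteToE (y - x)‖) ^ 4) +
                    (C₁ * (a β / κ) ^ 4) * (C₁ * (a β / κ) ^ 4) * (C₁ * (a β / κ) ^ 4)) +
                C₃ * (a β / κ) ^ 4 / (1 + min (min ‖siteToE (y - x)‖ ‖siteToE (z - y)‖) ‖siteToE (z - x)‖) ^ 8) ≤
          |∑ x ∈ box 4 ⌈ρ / a β⌉₊, ∑ y ∈ box 4 ⌈ρ / a β⌉₊, ∑ z ∈ box 4 ⌈ρ / a β⌉₊,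
            f (a β • siteToE x) * g (a β • siteToE y) * h (a β • siteToE z) *
              kerK3 G r β (fun _ => -(⌈ρ / a β⌉₊ : ℤ)) (2 * ⌈ρ / a β⌉₊ + 1) (ηr β) x y z|) :
    ∃ β₅' : ℝ, ∀ β : ℝ, β₅' ≤ β → ∀ L : ℕ, σ + κ + 1 ≤ a β * L → ε ≤ |Q3 G r β L (a β) f g h| := by
  obtain ⟨β₁, H1⟩ := hE1
  obtain ⟨β₂, H2⟩ := hE2
  obtain ⟨β₃, H3⟩ := hE3
  have hδ : 0 < min (min (1 / 4 : ℝ) ((ρ - σ - κ) / 2)) ((ℓ - 2 * (σ + κ)) / 5) :=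
    lt_min (lt_min (by norm_num) (by linarith)) (by linarith)
  obtain ⟨βa, Ha⟩ := eventually_le_of_tendsto ha hδ
  refine ⟨max (max β₅ βa) (max (max β₁ β₂) β₃), fun β hβ L hL => ?_⟩
  have hβ₅ : β₅ ≤ β := le_trans (le_max_left _ _) (le_trans (le_max_left _ _) hβ)
  have hβa : βa ≤ β := le_trans (le_max_right _ _) (le_trans (le_max_left _ _) hβ)
  have hβ₁ : β₁ ≤ β := le_trans (le_max_left _ _) (le_trans (le_max_left _ _) (le_trans (le_max_right _ _) hβ))
  have hβ₂ : β₂ ≤ β := le_trans (le_max_right _ _) (le_trans (le_max_left _ _) (le_trans (le_max_right _ _) hβ))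
  have hβ₃ : β₃ ≤ β := le_trans (le_max_right _ _) (le_trans (le_max_right _ _) hβ)
  have hα : 0 < a β := ha₀ β
  have hsmall := Ha β hβa
  have h4 : a β ≤ 1 / 4 := hsmall.trans ((min_le_left _ _).trans (min_le_left _ _))
  have hρ' : a β ≤ (ρ - σ - κ) / 2 := hsmall.trans ((min_le_left _ _).trans (min_le_right _ _))
  have hℓ' : a β ≤ (ℓ - 2 * (σ + κ)) / 5 := hsmall.trans (min_le_right _ _)
  obtain ⟨hRPR, hfem, hLL, hNL, hNR, hdep⟩ := scales hα hσ hκ h4 hρ' hℓ' hL (RP := ⌈(σ + κ) / a β⌉₊ + 1) rfl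
  have HRβ := HR β hβ₅
  set N := ⌈σ / a β⌉₊ with hN
  set R := ⌈ρ / a β⌉₊ with hR
  have hf0 : ∀ x, x ∉ box 4 N → f (a β • siteToE x) = 0 := fun x hx => apply_smul_siteToE_eq_zero hα hfσ hx
  have hg0 : ∀ y, y ∉ box 4 N → g (a β • siteToE y) = 0 := fun y hy => apply_smul_siteToE_eq_zero hα hgσ hy
  have hh0 : ∀ z, z ∉ box 4 N → h (a β • siteToE z) = 0 := fun z hz => apply_smul_siteToE_eq_zero hα hhσ hz
  -- per-triple transfer
  have htriple : ∀ x ∈ box 4 N, ∀ y ∈ box 4 N, ∀ z ∈ box 4 N,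
      |torusK3 G r β L x y z - kerK3 G r β (fun _ => -(R : ℤ)) (2 * R + 1) (ηr β) x y z| ≤
      2 * ((C₁ * (a β / κ) ^ 4) * (C₂ * (a β / κ) ^ 4 / (1 + ‖siteToE (z - y)‖) ^ 4) +
            (C₁ * (a β / κ) ^ 4) * (C₂ * (a β / κ) ^ 4 / (1 + ‖siteToE (z - x)‖) ^ 4) +
            (C₁ * (a β / κ) ^ 4) * (C₂ * (a β / κ) ^ 4 / (1 + ‖siteToE (y - x)‖) ^ 4) +
            (C₁ * (a β / κ) ^ 4) * (C₁ * (a β / κ) ^ 4) * (C₁ * (a β / κ) ^ 4)) +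
        C₃ * (a β / κ) ^ 4 / (1 + min (min ‖siteToE (y - x)‖ ‖siteToE (z - y)‖) ‖siteToE (z - x)‖) ^ 8 :=
    fun x hx y hy z hz => triple_transfer G r β hC₁ hC₂ hC₃ hκ hα hRPR hfem hLL hdep (H1 β hβ₁) (H2 β hβ₂)
      (H3 β hβ₃) (ηr β) hx hy hz
  -- the sums restricted to the support box
  have eQ : Q3 G r β L (a β) f g h = ∑ x ∈ box 4 N, ∑ y ∈ box 4 N, ∑ z ∈ box 4 N,
      f (a β • siteToE x) * g (a β • siteToE y) * h (a β • siteToE z) * torusK3 G r β L x y z := by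
    unfold Q3
    exact sum_box₃_eq hNL _ (fun x hx y z => by rw [hf0 x hx]; ring) (fun y hy x z => by rw [hg0 y hy]; ring)
      (fun z hz x y => by rw [hh0 z hz]; ring)
  have eR : ∑ x ∈ box 4 R, ∑ y ∈ box 4 R, ∑ z ∈ box 4 R,
      f (a β • siteToE x) * g (a β • siteToE y) * h (a β • siteToE z) *
        kerK3 G r β (fun _ => -(R : ℤ)) (2 * R + 1) (ηr β) x y z =
      ∑ x ∈ box 4 N, ∑ y ∈ box 4 N, ∑ z ∈ box 4 N,
      f (a β • siteToE x) * g (a β • siteToE y) * h (a β • siteToE z) *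
        kerK3 G r β (fun _ => -(R : ℤ)) (2 * R + 1) (ηr β) x y z :=
    sum_box₃_eq hNR _ (fun x hx y z => by rw [hf0 x hx]; ring) (fun y hy x z => by rw [hg0 y hy]; ring)
      (fun z hz x y => by rw [hh0 z hz]; ring)
  have eM : ∑ x ∈ box 4 R, ∑ y ∈ box 4 R, ∑ z ∈ box 4 R,
      |f (a β • siteToE x)| * |g (a β • siteToE y)| * |h (a β • siteToE z)| *
        (2 * ((C₁ * (a β / κ) ^ 4) * (C₂ * (a β / κ) ^ 4 / (1 + ‖siteToE (z - y)‖) ^ 4) +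
              (C₁ * (a β / κ) ^ 4) * (C₂ * (a β / κ) ^ 4 / (1 + ‖siteToE (z - x)‖) ^ 4) +
              (C₁ * (a β / κ) ^ 4) * (C₂ * (a β / κ) ^ 4 / (1 + ‖siteToE (y - x)‖) ^ 4) +
              (C₁ * (a β / κ) ^ 4) * (C₁ * (a β / κ) ^ 4) * (C₁ * (a β / κ) ^ 4)) +
          C₃ * (a β / κ) ^ 4 / (1 + min (min ‖siteToE (y - x)‖ ‖siteToE (z - y)‖) ‖siteToE (z - x)‖) ^ 8) =
      ∑ x ∈ box 4 N, ∑ y ∈ box 4 N, ∑ z ∈ box 4 N,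
      |f (a β • siteToE x)| * |g (a β • siteToE y)| * |h (a β • siteToE z)| *
        (2 * ((C₁ * (a β / κ) ^ 4) * (C₂ * (a β / κ) ^ 4 / (1 + ‖siteToE (z - y)‖) ^ 4) +
              (C₁ * (a β / κ) ^ 4) * (C₂ * (a β / κ) ^ 4 / (1 + ‖siteToE (z - x)‖) ^ 4) +
              (C₁ * (a β / κ) ^ 4) * (C₂ * (a β / κ) ^ 4 / (1 + ‖siteToE (y - x)‖) ^ 4) +
              (C₁ * (a β / κ) ^ 4) * (C₁ * (a β / κ) ^ 4) * (C₁ * (a β / κ) ^ 4)) +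
          C₃ * (a β / κ) ^ 4 / (1 + min (min ‖siteToE (y - x)‖ ‖siteToE (z - y)‖) ‖siteToE (z - x)‖) ^ 8) :=
    sum_box₃_eq hNR _ (fun x hx y z => by rw [hf0 x hx, abs_zero]; ring)
      (fun y hy x z => by rw [hg0 y hy, abs_zero]; ring) (fun z hz x y => by rw [hh0 z hz, abs_zero]; ring)
  have hsum := abs_sum₃_sub_sum₃_le (box 4 N) (fun x => f (a β • siteToE x)) (fun y => g (a β • siteToE y))
    (fun z => h (a β • siteToE z)) (fun x y z => torusK3 G r β L x y z)
    (fun x y z => kerK3 G r β (fun _ => -(R : ℤ)) (2 * R + 1) (ηr β) x y z) _ htriple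
  rw [eR, eM] at HRβ
  rw [eQ]
  have tri := abs_sub_abs_le_abs_sub
    (∑ x ∈ box 4 N, ∑ y ∈ box 4 N, ∑ z ∈ box 4 N,
      f (a β • siteToE x) * g (a β • siteToE y) * h (a β • siteToE z) *
        kerK3 G r β (fun _ => -(R : ℤ)) (2 * R + 1) (ηr β) x y z)
    (∑ x ∈ box 4 N, ∑ y ∈ box 4 N, ∑ z ∈ box 4 N,
      f (a β • siteToE x) * g (a β • siteToE y) * h (a β • siteToE z) * torusK3 G r β L x y z)
  rw [abs_sub_comm] at hsum
  linarith [hsum, HRβ, tri]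


end Explicit

end Summit.QuantumFields.YangMills.Cruxes.NT.Reference

end
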